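import Mathlib
import Summits.Ventures.HodgeRepro.Tier4.Common.AdelicDefs
import Summits.Ventures.HodgeRepro.Tier4.Line1.LocallyCompactGA
import Summits.Ventures.HodgeRepro.Tier4.Line1.SecondCountableGA

/-!
# Tier4/Line1/HaarFiniteOrder — a continuous additive automorphism of finite order preserves every Haar measure

Blind re-derivation cell `pub-hodge-repro`, Tier 4 (README §9–§10), seat t4-L1-p2 (prover, LINE L1, gen 0).
Support module for the cocompactness cut R-c of LINE L1 (t4-L1-p5's rung file `I1c-rungs-sig.lean`; p5's call
S12836 (a)): the Mathlib-level statement «a continuous additive automorphism of finite order of a locally compact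
second-countable additive group preserves every Haar measure», and its instance «scaling `𝔸_k⁴` by a sign adele `ε`
(`ε² = 1`) preserves every Haar measure on `𝔸_k⁴`».

PROOF.  By uniqueness of Haar measure on a locally compact second-countable group, `map e μ = c • μ` with
`c = addHaarScalarFactor (map e μ) μ`; iterating, `μ = map e^[n] μ = c^n • μ`, so `c^n = 1` on a compact set of
positive finite measure, hence `c = 1`.

THIS MODULE DOES NOT CLOSE C5 (`measure_vecMul_GA`, the Haar modulus of `x ↦ x g` for `g ∈ U(W)(𝔸_k)`): it handles
only automorphisms of finite order (the scalar sign adeles, the conjugations), not a general unitary matrix.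
HC_CM is NOT proved by anyone in this repository.
-/

set_option autoImplicit false

noncomputable section

namespace Summit.Ventures.HodgeRepro.Tier4.Line1

open MeasureTheory Measure Topology NumberField Common
open scoped ENNReal NNReal

section FiniteOrder

variable {G : Type*} [AddCommGroup G] [TopologicalSpace G] [IsTopologicalAddGroup G]
  [MeasurableSpace G] [BorelSpace G] [LocallyCompactSpace G] [SecondCountableTopology G]

/-- the pushforward of a Haar measure under the `m`-th iterate of a continuous additive automorphism is
`c^m` times the measure, `c` the Haar scalar factor of the first pushforward -/
theorem map_iterate_addHaar (μ : Measure G) [μ.IsAddHaarMeasure] (e : G ≃ₜ+ G) (m : ℕ) :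
    μ.map (e^[m]) = ((μ.map e).addHaarScalarFactor μ ^ m) • μ := by
  set c : ℝ≥0 := (μ.map e).addHaarScalarFactor μ with hc
  have h1 : μ.map e = c • μ := isAddLeftInvariant_eq_smul (μ.map e) μ
  induction m with
  | zero => simp
  | succ m ih =>
    have hm : Measurable (e^[m] : G → G) := (e.continuous.iterate m).measurable
    have hme : Measurable (e : G → G) := by exact e.continuous.measurable
    rw [Function.iterate_succ', ← Measure.map_map hme hm, ih, Measure.map_smul, h1, smul_smul, pow_succ]

/-- **a continuous additive automorphism of finite order preserves every Haar measure** -/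
theorem map_eq_self_of_iterate_eq_id (μ : Measure G) [μ.IsAddHaarMeasure] (e : G ≃ₜ+ G) {n : ℕ}
    (hn : n ≠ 0) (he : ∀ x, e^[n] x = x) : μ.map e = μ := by
  set c : ℝ≥0 := (μ.map e).addHaarScalarFactor μ with hc
  have hid : (e^[n] : G → G) = id := funext he
  have h1 := map_iterate_addHaar μ e n
  rw [hid, Measure.map_id] at h1
  -- a compact set of positive finite measure
  obtain ⟨K, hKc, hKn⟩ := exists_compact_mem_nhds (0 : G)
  have hKpos : 0 < μ K := measure_pos_of_mem_nhds μ hKn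
  have hKfin : μ K < ∞ := hKc.measure_lt_top
  have h2 := congrArg (fun ν : Measure G => ν K) h1
  simp only [Measure.smul_apply] at h2
  have h3 : ((c ^ n : ℝ≥0) : ℝ≥0∞) = 1 := (ENNReal.mul_eq_right hKpos.ne' hKfin.ne).1 h2.symm
  have h4 : c ^ n = 1 := by exact_mod_cast h3
  have h5 : c = 1 := (pow_eq_one_iff_of_nonneg zero_le hn).1 h4
  rw [isAddLeftInvariant_eq_smul (μ.map e) μ, ← hc, h5, one_smul]

omit [IsTopologicalAddGroup G] [LocallyCompactSpace G] [SecondCountableTopology G] in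
/-- a continuous additive automorphism whose pushforward fixes `μ` preserves the measure of every image set
(no measurability hypothesis: the automorphism is a measurable equivalence) -/
theorem measure_image_eq_of_map_eq (μ : Measure G) (e : G ≃ₜ+ G) (h : μ.map e = μ) (S : Set G) :
    μ (e '' S) = μ S := by
  have hmap : μ.map e (e '' S) = μ (e ⁻¹' (e '' S)) :=
    e.toHomeomorph.toMeasurableEquiv.map_apply (e '' S)
  rw [h, Set.preimage_image_eq S e.injective] at hmap
  exact hmap

/-- **an involutive continuous additive automorphism preserves every Haar measure** -/
theorem map_eq_self_of_involutive (μ : Measure G) [μ.IsAddHaarMeasure] (e : G ≃ₜ+ G)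
    (he : ∀ x, e (e x) = x) : μ.map e = μ :=
  map_eq_self_of_iterate_eq_id μ e (n := 2) two_ne_zero (fun x => by
    simp only [Function.iterate_succ, Function.iterate_zero, Function.comp_apply, id]
    exact he x)

end FiniteOrder

section SignAdele

variable (k : Type) [Field k] [NumberField k]

/-- **scaling `𝔸_k⁴` by a sign adele preserves every Haar measure**: for `ε ∈ 𝔸_k` with `ε² = 1` the scaling
`x ↦ ε • x` of `𝔸_k⁴` is an involutive continuous additive automorphism, so `map (ε • ·) μ = μ` for every Haar
measure `μ` on `𝔸_k⁴` (the «scalar case» of the modulus rung C5 of the R-c cut; it does NOT close C5). -/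
theorem map_smul_eq_self_of_mul_self_eq_one [MeasurableSpace (Fin 4 → Ad k)] [BorelSpace (Fin 4 → Ad k)]
    (μ : Measure (Fin 4 → Ad k)) [μ.IsAddHaarMeasure] {ε : Ad k} (hε : ε * ε = 1) :
    μ.map (fun x : Fin 4 → Ad k => ε • x) = μ := by
  haveI := locallyCompactSpace_adeleRing k
  haveI := secondCountable_adeleRing k
  have hinv : ∀ x : Fin 4 → Ad k, ε • ε • x = x := by
    intro x
    rw [smul_smul, hε, one_smul]
  let e : (Fin 4 → Ad k) ≃ₜ+ (Fin 4 → Ad k) :=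
    { toFun := fun x => ε • x
      invFun := fun x => ε • x
      left_inv := hinv
      right_inv := hinv
      map_add' := fun x y => smul_add ε x y
      continuous_toFun := continuous_pi fun i => continuous_const.mul (continuous_apply i)
      continuous_invFun := continuous_pi fun i => continuous_const.mul (continuous_apply i) }
  exact map_eq_self_of_involutive μ e hinv

/-- the image form of `map_smul_eq_self_of_mul_self_eq_one`: `μ (ε • S) = μ S` for every `S ⊆ 𝔸_k⁴`
(no measurability hypothesis on `S`) -/
theorem measure_smul_image_eq_of_mul_self_eq_one [MeasurableSpace (Fin 4 → Ad k)]
    [BorelSpace (Fin 4 → Ad k)] (μ : Measure (Fin 4 → Ad k)) [μ.IsAddHaarMeasure] {ε : Ad k}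
    (hε : ε * ε = 1) (S : Set (Fin 4 → Ad k)) :
    μ ((fun x : Fin 4 → Ad k => ε • x) '' S) = μ S := by
  haveI := locallyCompactSpace_adeleRing k
  haveI := secondCountable_adeleRing k
  have hinv : ∀ x : Fin 4 → Ad k, ε • ε • x = x := by
    intro x
    rw [smul_smul, hε, one_smul]
  let e : (Fin 4 → Ad k) ≃ₜ+ (Fin 4 → Ad k) :=
    { toFun := fun x => ε • x
      invFun := fun x => ε • x
      left_inv := hinv
      right_inv := hinv
      map_add' := fun x y => smul_add ε x y
      continuous_toFun := continuous_pi fun i => continuous_const.mul (continuous_apply i)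
      continuous_invFun := continuous_pi fun i => continuous_const.mul (continuous_apply i) }
  exact measure_image_eq_of_map_eq μ e (map_eq_self_of_involutive μ e hinv) S

end SignAdele

end Summit.Ventures.HodgeRepro.Tier4.Line1

end
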